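import Literature.MathematicalPhysics.QuantumLattice.FlowWeightedLiebRobinsonProofs
import Literature.MathematicalPhysics.QuantumLattice.QuasiLocalPiecesProofs
import Literature.MathematicalPhysics.QuantumLattice.TorusLiebRobinsonProofs
import Literature.MathematicalPhysics.QuantumLattice.CorrelationLightConeLattice
import Mathlib.Analysis.PSeries
import Literature.MathematicalPhysics.QuantumLattice.QuasiLocalAverageProofs
import Literature.MathematicalPhysics.QuantumLattice.FlowDisplacementProofs
import Literature.MathematicalPhysics.QuantumLattice.SmoothingLocalityProofs
import HarnessLib

/-!
# Locality of the flow of ball-indexed quasi-local generators on decorated tori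

Nineteenth file of the formalisation of the Michalakis–Zwolak stability theorem (hubbard.S19):
MZ13 §5.2 Lemma 2 (the quasi-adiabatic unitary `U(s)` generated by
`D(s) = Σ_u Σ_k D_u(k, s)`, `D_u(k,s) ∈ 𝔄_{b_u(r+k)}` with rapidly decaying norms, satisfies a
Lieb–Robinson bound uniformly in the volume), assembled from the size-weighted two-scale flow
bound `norm_comm_flow_le_exp_weighted`, the grouping of pieces into interactions
(`QuasiLocalPiecesProofs`) and the torus grading (`TorusLiebRobinsonProofs`):
`norm_comm_flow_pieces_le` —
`‖[α_s(O), B]‖ ≤ 2‖O‖‖B‖ |b_x(r')| (exp(−μ⌊(ℓ+1)/(2(r+ℓ₀)+1)⌋ + 2e^μ J s) + (K/J) exp(2Js))`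
for `O ∈ 𝔄_{b_x(r')}`, `B` supported outside `b_x(r'+ℓ)`, with `J ≥ Σ_k (2(r+k)+1)^{2d}|κ| G k`
and the tail `K ≥ Σ_{k>ℓ₀} (2(r+k)+1)^d G k` beyond the splitting scale `ℓ₀`;
`norm_flow_sub_twirl_pieces_le` — the same bound for the localisation error
`‖α_s(O) − 𝔼_{b_x(r'+ℓ)ᶜ}(α_s(O))‖` (MZ13 Lemma 2 as used: `α_s(O) = Σ_{r'} 𝒮(r'; O)`);
`sum_indicator_pow_mul_le` — tails of superpolynomially decaying sequences against polynomial
(ball-volume) weights, for the constants `K(ℓ₀)`; `twirl_eq_self_of_isSupportedOn` (strictly local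
observables are fixed by the twirl) and `norm_flow_sub_twirl_centred_le` — the flow of an
observable that is only centred (quasi-local with tails `E`), by splitting at an intermediate
scale.
Finally, `norm_flow_sub_twirl_centred_le_div_pow` restates the flow of a centred observable in
the power-bound format consumed downstream (`‖α_s(O) − 𝔼_{b_x(r'+ℓ)ᶜ}(α_s O)‖ ≤ Bd p/(ℓ+1)^p`
for all `p`, with `Bd` explicit in the data), choosing the scales `m = ℓ/2`, `ℓ₀ = Nat.sqrt ℓ`
(decay toolkit: `exp_neg_mul_sqrt_le`, `div_sqrt_pow_le`, `div_half_pow_le`,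
`exp_neg_mul_floor_le_div_pow`).

No definitions, no named facts (theorems only). [folklore]
-/

noncomputable section

open Matrix Complex Set Filter MeasureTheory Topology
open scoped Matrix Matrix.Norms.L2Operator

namespace Literature.MathematicalPhysics.QuantumLattice

/-! ### The flow of ball-indexed quasi-local pieces on a decorated torus -/

section TorusFlow

open Finset Literature.Probability.LatticeModels

variable {d L : ℕ} [NeZero L] {κ : Type*} [Fintype κ] [DecidableEq κ] {q : ℕ}

omit [DecidableEq κ] in
/-- The grouped interaction of size-weighted pieces is the size-weighted grouped interaction.
[folklore] -/
theorem reindex_smul_card {Λ' : Type*} [DecidableEq Λ'] {ι : Type*} [Fintype ι] (S : ι → Finset Λ')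
    (P : ι → Op Λ' q) (Z : Finset Λ') :
    ∑ i ∈ univ.filter (fun i => S i = Z), (((#(S i) : ℕ) : ℂ) • P i) =
      ((#Z : ℕ) : ℂ) • ∑ i ∈ univ.filter (fun i => S i = Z), P i := by
  rw [Finset.smul_sum]
  refine sum_congr rfl fun i hi => ?_
  simp only [mem_filter, Finset.mem_univ, true_and] at hi
  rw [hi]

/-- **Lieb–Robinson bound for the flow generated by ball-indexed quasi-local pieces on the torus
(two-scale form, uniform in the volume).** Let the generator be `Σ_{u,k} P_s(u,k)` with
`P_s(u,k) ∈ 𝔄_{b_u(r+k)}` Hermitian, continuous in `s`, `‖P_s(u,k)‖ ≤ G k`. With the constants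
`J ≥ Σ_k (2(r+k)+1)^{2d} |κ| G k`, `J ≥ 1` (size-weighted local norm) and
`K ≥ Σ_{k > ℓ₀} (2(r+k)+1)^d G k` (long-range tail beyond the splitting scale `ℓ₀`), for `O`
on `b_x(r')`, `B` supported outside `b_x(r'+ℓ)`, `ℓ ≥ 2(r+ℓ₀)` and `μ ≥ 0`:
`‖[α_s(O), B]‖ ≤ 2‖O‖‖B‖ |b_x(r')| (exp(−μ⌊(ℓ+1)/(2(r+ℓ₀)+1)⌋ + 2e^μ J s) + (K/J) exp(2Js))`.
MZ13 §5.2 Lemma 2 ("the unitary `U(s)` … satisfies a Lieb–Robinson bound … with rapidly decaying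
`f`"), here from `norm_comm_flow_le_exp_weighted` with the torus grading of
`TorusLiebRobinsonProofs`. [folklore] -/
theorem norm_comm_flow_pieces_le (r M : ℕ) {T : ℝ}
    (P : ℝ → TorusSite d L × Fin (M + 1) → Op (TorusSite d L × κ) q)
    (hPsupp : ∀ s (i : TorusSite d L × Fin (M + 1)),
      IsSupportedOn (P s i) (cellBall i.1 (r + i.2) : Finset (TorusSite d L × κ)))
    (hPherm : ∀ s i, (P s i).IsHermitian)
    (hPc : ∀ i, ContinuousOn (fun s => P s i) (Icc 0 T))
    {G : ℕ → ℝ} (hG0 : ∀ k, 0 ≤ G k) (hPG : ∀ s ∈ Icc 0 T, ∀ (u : TorusSite d L) (k : Fin (M + 1)),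
      ‖P s (u, k)‖ ≤ G k)
    {U : ℝ → Op (TorusSite d L × κ) q} (hU0 : U 0 = 1)
    (hU : ∀ s ∈ Icc 0 T, HasDerivWithinAt U (((I : ℂ) • localHamiltonian
      (fun Z : Finset (TorusSite d L × κ) => ∑ i ∈ univ.filter
        (fun i : TorusSite d L × Fin (M + 1) =>
          (cellBall i.1 (r + i.2) : Finset (TorusSite d L × κ)) = Z), P s i) univ) * U s) (Icc 0 T) s)
    (hU1 : ∀ s ∈ Icc 0 T, (U s)ᴴ * U s = 1) (hU2 : ∀ s ∈ Icc 0 T, U s * (U s)ᴴ = 1)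
    (x : TorusSite d L) {r' ℓ ℓ₀ : ℕ} (hℓ : 2 * (r + ℓ₀) ≤ ℓ)
    {O B : Op (TorusSite d L × κ) q} (hO : IsSupportedOn O (cellBall x r'))
    {Yset : Finset (TorusSite d L × κ)} (hY : Disjoint (cellBall x (r' + ℓ)) Yset)
    (hB : IsSupportedOn B Yset)
    {J : ℝ} (hJ1 : 1 ≤ J)
    (hJ : ∑ k : Fin (M + 1), ((2 * (r + k) + 1) ^ d : ℕ) *
      ((((2 * (r + k) + 1) ^ d * Fintype.card κ : ℕ) : ℝ) * G k) ≤ J)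
    {K : ℝ} (hK0 : 0 ≤ K)
    (hK : ∑ k : Fin (M + 1), (if ℓ₀ < (k : ℕ) then ((2 * (r + k) + 1) ^ d : ℕ) * G k else 0) ≤ K)
    {μ : ℝ} (hμ : 0 ≤ μ) {s : ℝ} (hs : s ∈ Icc 0 T) :
    ‖(U s)ᴴ * O * U s * B - B * ((U s)ᴴ * O * U s)‖ ≤
      2 * ‖O‖ * ‖B‖ * #(cellBall x r' : Finset (TorusSite d L × κ)) *
        (Real.exp (-(μ * ((((ℓ + 1) / (2 * (r + ℓ₀) + 1)) : ℕ) : ℝ)) + 2 * Real.exp μ * J * s) +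
          K / J * Real.exp (2 * J * s)) := by
  -- abbreviations
  set S : TorusSite d L × Fin (M + 1) → Finset (TorusSite d L × κ) :=
    fun i => cellBall i.1 (r + i.2) with hS
  set Ψ : ℝ → Interaction (TorusSite d L × κ) q :=
    fun s Z => ∑ i ∈ univ.filter (fun i => S i = Z), P s i with hΨ
  set r₀ : ℕ := 2 * (r + ℓ₀) with hr₀
  have hJ0 : 0 ≤ J := zero_le_one.trans hJ1
  have hJpos : 0 < J := zero_lt_one.trans_le hJ1
  -- locality and continuity of the grouped interaction
  have hΨloc : ∀ s, (Ψ s).IsLocal := fun s => isLocal_reindex S (fun i => hPsupp s i) (hPherm s)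
  have hΨc : ∀ Z, ContinuousOn (fun s => Ψ s Z) (Icc 0 T) := fun Z => by
    simp only [hΨ]
    exact continuousOn_finsetSum _ fun i _ => hPc i
  -- short-range predicate and grading
  set R : Finset (TorusSite d L × κ) → Prop := fun Z => torusDiam Z ≤ r₀ with hR
  haveI : DecidablePred R := fun Z => Nat.decLe _ _
  set δ : Finset (TorusSite d L × κ) → ℕ := fun Z =>
    (r' + ℓ + 1 - Z.sup fun z => torusDist x z.1) / (r₀ + 1) with hδ
  have hδY : ∀ Z, 0 < δ Z → Disjoint Z Yset := fun Z hZ => disjoint_of_grading_pos x r' ℓ r₀ hZ hY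
  have hδstep : ∀ Z Z', R Z' → ¬ Disjoint Z' Z → δ Z ≤ δ Z' + 1 := fun Z Z' hRZ' hZZ' =>
    grading_le_grading_add_one x r' ℓ r₀ hRZ' hZZ'
  have hX : 0 < δ (cellBall x r') := by
    have h1 := div_le_grading_cellBall (κ := κ) x r' ℓ r₀
    have h2 : 0 < (ℓ + 1) / (r₀ + 1) := Nat.div_pos (by omega) (Nat.succ_pos r₀)
    exact lt_of_lt_of_le h2 h1
  -- the size-weighted local norm
  have hJw : ∀ s ∈ Icc 0 T, ∀ y : TorusSite d L × κ,
      ∑ Z ∈ univ.filter (fun Z : Finset (TorusSite d L × κ) => y ∈ Z), (#Z : ℝ) * ‖Ψ s Z‖ ≤ J := by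
    intro s hs' y
    have h1 := sum_norm_reindex_le S (fun i => (((#(S i) : ℕ) : ℂ) • P s i)) y
    have hrew : ∀ Z : Finset (TorusSite d L × κ), (#Z : ℝ) * ‖Ψ s Z‖ =
        ‖∑ i ∈ univ.filter (fun i => S i = Z), (((#(S i) : ℕ) : ℂ) • P s i)‖ := by
      intro Z
      rw [reindex_smul_card, norm_smul, Complex.norm_natCast]
    simp only [hrew]
    refine h1.trans ?_
    have h2 := sum_norm_pieces_le (κ := κ) r M (fun i => (((#(S i) : ℕ) : ℂ) • P s i))
      (G := fun k => (((2 * (r + k) + 1) ^ d * Fintype.card κ : ℕ) : ℝ) * G k)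
      (fun k => mul_nonneg (Nat.cast_nonneg _) (hG0 k)) (fun u k => ?_) y (fun _ => True)
    · simp only [and_true, if_true] at h2
      exact h2.trans hJ
    · rw [norm_smul, Complex.norm_natCast]
      have hc := card_cellBall_le (κ := κ) u (r + k)
      have hc' : ((#(S (u, k)) : ℕ) : ℝ) ≤ (((2 * (r + k) + 1) ^ d * Fintype.card κ : ℕ) : ℝ) := by
        exact_mod_cast hc
      exact mul_le_mul hc' (hPG s hs' u k) (norm_nonneg _) (Nat.cast_nonneg _)
  -- the long-range part
  have hJ' : ∀ s ∈ Icc 0 T, ∀ y : TorusSite d L × κ,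
      ∑ Z ∈ univ.filter (fun Z : Finset (TorusSite d L × κ) => y ∈ Z),
        ‖(if R Z then (0 : Op (TorusSite d L × κ) q) else Ψ s Z)‖ ≤ K / J * J := by
    intro s hs' y
    rw [div_mul_cancel₀ K hJpos.ne']
    have h1 := sum_norm_reindex_not_le S (P s) y R
    refine h1.trans ?_
    -- `¬R (b_u(r+k))` forces `k > ℓ₀`
    have hsub : (univ.filter fun i : TorusSite d L × Fin (M + 1) => y ∈ S i ∧ ¬ R (S i)) ⊆
        univ.filter fun i : TorusSite d L × Fin (M + 1) =>
          y ∈ (cellBall i.1 (r + i.2) : Finset (TorusSite d L × κ)) ∧ ℓ₀ < (i.2 : ℕ) := by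
      intro i hi
      simp only [mem_filter, Finset.mem_univ, true_and] at hi ⊢
      refine ⟨hi.1, ?_⟩
      by_contra hk
      apply hi.2
      show torusDiam (S i) ≤ r₀
      -- a ball of radius `r + k` has diameter `≤ 2(r+k)` (triangle inequality)
      have hdiam : torusDiam (S i) ≤ 2 * (r + i.2) := by
        refine Finset.sup_le fun a ha => Finset.sup_le fun b hb => ?_
        rw [hS] at ha hb
        simp only at ha hb
        rw [mem_cellBall_iff] at ha hb
        calc torusDist a.1 b.1 ≤ torusDist a.1 i.1 + torusDist i.1 b.1 :=
              torusDist_triangle_holds a.1 i.1 b.1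
          _ ≤ (r + i.2) + (r + i.2) := add_le_add (by rw [torusDist_comm_holds]; exact ha) hb
          _ = 2 * (r + i.2) := by ring
      calc torusDiam (S i) ≤ 2 * (r + i.2) := hdiam
        _ ≤ r₀ := by rw [hr₀]; omega
    refine (sum_le_sum_of_subset_of_nonneg hsub fun i _ _ => norm_nonneg _).trans ?_
    have h2 := sum_norm_pieces_le (κ := κ) r M (P s) hG0 (fun u k => hPG s hs' u k) y
      (fun k : Fin (M + 1) => ℓ₀ < (k : ℕ))
    exact h2.trans hK
  -- apply the weighted flow bound
  have hmain := norm_comm_flow_le_exp_weighted hΨloc hΨc hU0 hU hU1 hU2 (R := R) hO hB δ hδY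
    hδstep hX hJ0 hJw (div_nonneg hK0 hJ0) hJ' hμ hs
  refine hmain.trans (mul_le_mul_of_nonneg_left (add_le_add (Real.exp_le_exp.mpr ?_) le_rfl)
    (by positivity))
  have h1 := div_le_grading_cellBall (κ := κ) x r' ℓ r₀
  have h2 : ((((ℓ + 1) / (r₀ + 1)) : ℕ) : ℝ) ≤ (δ (cellBall x r') : ℝ) := by exact_mod_cast h1
  nlinarith

end TorusFlow

/-! ### Localisation of the flow by the twirl, and the decay toolkit -/

section TorusFlowTwirl

open Finset Literature.Probability.LatticeModels

variable {d L : ℕ} [NeZero L] {κ : Type*} [Fintype κ] [DecidableEq κ] {q : ℕ}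

/-- **MZ13 Lemma 2, localised form.** Under the hypotheses of `norm_comm_flow_pieces_le`, the
evolved observable `α_s(O)`, `O ∈ 𝔄_{b_x(r')}`, is within
`2‖O‖ |b_x(r')| (exp(−μ⌊(ℓ+1)/(2(r+ℓ₀)+1)⌋ + 2e^μ J s) + (K/J) exp(2Js))` of its twirl
localisation onto the ball `b_x(r'+ℓ)` (`norm_sub_twirl_le`).
[cite: MichalakisZwolakCMP2013, §5.2 Lemma 2 (arXiv:1109.1588 p. 10)] -/
theorem norm_flow_sub_twirl_pieces_le (r M : ℕ) {T : ℝ}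
    (P : ℝ → TorusSite d L × Fin (M + 1) → Op (TorusSite d L × κ) q)
    (hPsupp : ∀ s (i : TorusSite d L × Fin (M + 1)),
      IsSupportedOn (P s i) (cellBall i.1 (r + i.2) : Finset (TorusSite d L × κ)))
    (hPherm : ∀ s i, (P s i).IsHermitian)
    (hPc : ∀ i, ContinuousOn (fun s => P s i) (Icc 0 T))
    {G : ℕ → ℝ} (hG0 : ∀ k, 0 ≤ G k) (hPG : ∀ s ∈ Icc 0 T, ∀ (u : TorusSite d L) (k : Fin (M + 1)),
      ‖P s (u, k)‖ ≤ G k)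
    {U : ℝ → Op (TorusSite d L × κ) q} (hU0 : U 0 = 1)
    (hU : ∀ s ∈ Icc 0 T, HasDerivWithinAt U (((I : ℂ) • localHamiltonian
      (fun Z : Finset (TorusSite d L × κ) => ∑ i ∈ univ.filter
        (fun i : TorusSite d L × Fin (M + 1) =>
          (cellBall i.1 (r + i.2) : Finset (TorusSite d L × κ)) = Z), P s i) univ) * U s) (Icc 0 T) s)
    (hU1 : ∀ s ∈ Icc 0 T, (U s)ᴴ * U s = 1) (hU2 : ∀ s ∈ Icc 0 T, U s * (U s)ᴴ = 1)
    (x : TorusSite d L) {r' ℓ ℓ₀ : ℕ} (hℓ : 2 * (r + ℓ₀) ≤ ℓ)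
    {O : Op (TorusSite d L × κ) q} (hO : IsSupportedOn O (cellBall x r'))
    {J : ℝ} (hJ1 : 1 ≤ J)
    (hJ : ∑ k : Fin (M + 1), ((2 * (r + k) + 1) ^ d : ℕ) *
      ((((2 * (r + k) + 1) ^ d * Fintype.card κ : ℕ) : ℝ) * G k) ≤ J)
    {K : ℝ} (hK0 : 0 ≤ K)
    (hK : ∑ k : Fin (M + 1), (if ℓ₀ < (k : ℕ) then ((2 * (r + k) + 1) ^ d : ℕ) * G k else 0) ≤ K)
    {μ : ℝ} (hμ : 0 ≤ μ) {s : ℝ} (hs : s ∈ Icc 0 T) :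
    ‖(U s)ᴴ * O * U s - twirl (cellBall x (r' + ℓ))ᶜ ((U s)ᴴ * O * U s)‖ ≤
      2 * ‖O‖ * #(cellBall x r' : Finset (TorusSite d L × κ)) *
        (Real.exp (-(μ * ((((ℓ + 1) / (2 * (r + ℓ₀) + 1)) : ℕ) : ℝ)) + 2 * Real.exp μ * J * s) +
          K / J * Real.exp (2 * J * s)) := by
  refine norm_sub_twirl_le _ _ fun B hB hBu => ?_
  have h := norm_comm_flow_pieces_le r M P hPsupp hPherm hPc hG0 hPG hU0 hU hU1 hU2 x hℓ hO
    (Yset := (cellBall x (r' + ℓ))ᶜ) disjoint_compl_right hB hJ1 hJ hK0 hK hμ hs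
  refine h.trans ?_
  have hB1 : ‖B‖ ≤ 1 := by
    rcases subsingleton_or_nontrivial (Op (TorusSite d L × κ) q) with hsub | hnt
    · rw [Subsingleton.elim B 0, norm_zero]; exact zero_le_one
    · exact (CStarRing.norm_of_mem_unitary hBu).le
  have hJ0 : 0 ≤ J := zero_le_one.trans hJ1
  have hE : 0 ≤ Real.exp (-(μ * ((((ℓ + 1) / (2 * (r + ℓ₀) + 1)) : ℕ) : ℝ)) + 2 * Real.exp μ * J * s) +
      K / J * Real.exp (2 * J * s) := by positivity
  have hO0 := norm_nonneg O
  calc 2 * ‖O‖ * ‖B‖ * #(cellBall x r' : Finset (TorusSite d L × κ)) * _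
      ≤ 2 * ‖O‖ * 1 * #(cellBall x r' : Finset (TorusSite d L × κ)) * _ := by gcongr
    _ = _ := by ring

/-! #### Decay toolkit: tails of superpolynomially decaying sequences -/

/-- **Tails of a superpolynomially decaying sequence against a polynomial weight decay
superpolynomially**: if `G k ≤ C/(k+1)^{p+n+2}` then
`Σ_{m < k ≤ M} (a(k+1))^n G k ≤ 2 aⁿ C/(m+1)^p` for all `m`, `M` (termwise comparison and
`Σ_{k>m} 1/k² ≤ 2/(m+1)`, Mathlib `sum_Ioo_inv_sq_le`). Used with the ball-volume weights
`(2(r+k)+1)^d ≤ ((2r+2)(k+1))^d` of MZ13 §5. [folklore] -/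
theorem sum_indicator_pow_mul_le {G : ℕ → ℝ} {C a : ℝ} (hC : 0 ≤ C) (ha : 0 ≤ a) (p n : ℕ)
    (hG : ∀ k : ℕ, G k ≤ C / ((k : ℝ) + 1) ^ (p + n + 2)) (m M : ℕ) :
    ∑ k ∈ Finset.range (M + 1), (if m < k then (a * ((k : ℝ) + 1)) ^ n * G k else 0) ≤
      2 * a ^ n * C / ((m : ℝ) + 1) ^ p := by
  have hm0 : (0 : ℝ) < (m : ℝ) + 1 := by positivity
  -- the indicator sum is a sum over `Ioo m (M+1)`
  have hset : ∑ k ∈ Finset.range (M + 1), (if m < k then (a * ((k : ℝ) + 1)) ^ n * G k else 0) =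
      ∑ k ∈ Finset.Ioo m (M + 1), (a * ((k : ℝ) + 1)) ^ n * G k := by
    rw [← Finset.sum_filter]
    refine Finset.sum_congr ?_ fun _ _ => rfl
    ext k
    simp only [Finset.mem_filter, Finset.mem_range, Finset.mem_Ioo]
    tauto
  rw [hset]
  -- termwise: for `k > m`, `(a(k+1))^n G k ≤ aⁿ C/(m+1)^p · 1/k²`
  have hterm : ∀ k ∈ Finset.Ioo m (M + 1), (a * ((k : ℝ) + 1)) ^ n * G k ≤
      a ^ n * C / ((m : ℝ) + 1) ^ p * ((k : ℝ) ^ 2)⁻¹ := by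
    intro k hk
    rw [Finset.mem_Ioo] at hk
    have hk1 : 1 ≤ k := by omega
    have hkr : (1 : ℝ) ≤ k := by exact_mod_cast hk1
    have hk0 : (0 : ℝ) < k := by positivity
    have hmk : (m : ℝ) + 1 ≤ (k : ℝ) + 1 := by exact_mod_cast Nat.succ_le_succ hk.1.le
    calc (a * ((k : ℝ) + 1)) ^ n * G k
        ≤ (a * ((k : ℝ) + 1)) ^ n * (C / ((k : ℝ) + 1) ^ (p + n + 2)) :=
          mul_le_mul_of_nonneg_left (hG k) (by positivity)
      _ = a ^ n * C * (1 / ((k : ℝ) + 1) ^ p) * (1 / ((k : ℝ) + 1) ^ 2) := by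
          rw [mul_pow]; field_simp; ring
      _ ≤ a ^ n * C * (1 / ((m : ℝ) + 1) ^ p) * ((k : ℝ) ^ 2)⁻¹ := by
          refine mul_le_mul ?_ ?_ (by positivity) (by positivity)
          · refine mul_le_mul_of_nonneg_left ?_ (by positivity)
            exact one_div_le_one_div_of_le (by positivity) (pow_le_pow_left₀ hm0.le hmk p)
          · rw [one_div, inv_le_inv₀ (by positivity) (by positivity)]
            nlinarith
      _ = a ^ n * C / ((m : ℝ) + 1) ^ p * ((k : ℝ) ^ 2)⁻¹ := by ring
  refine (Finset.sum_le_sum hterm).trans ?_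
  rw [← Finset.mul_sum]
  have htail : ∑ k ∈ Finset.Ioo m (M + 1), ((k : ℝ) ^ 2)⁻¹ ≤ 2 / ((m : ℝ) + 1) := sum_Ioo_inv_sq_le m (M + 1)
  have hle1 : 2 / ((m : ℝ) + 1) ≤ 2 := by
    rw [div_le_iff₀ hm0]; have : (0:ℝ) ≤ m := Nat.cast_nonneg _; linarith
  calc a ^ n * C / ((m : ℝ) + 1) ^ p * ∑ k ∈ Finset.Ioo m (M + 1), ((k : ℝ) ^ 2)⁻¹
      ≤ a ^ n * C / ((m : ℝ) + 1) ^ p * 2 :=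
        mul_le_mul_of_nonneg_left (htail.trans hle1) (by positivity)
    _ = 2 * a ^ n * C / ((m : ℝ) + 1) ^ p := by ring

end TorusFlowTwirl

/-! ### Flow of centred (quasi-local) observables -/

section Centred

open Finset Literature.Probability.LatticeModels

variable {Λ' : Type*} [Fintype Λ'] [DecidableEq Λ'] {q : ℕ}

end Centred

section CentredTorus

open Finset Literature.Probability.LatticeModels

variable {d L : ℕ} [NeZero L] {κ : Type*} [Fintype κ] [DecidableEq κ] {q : ℕ}

/-- **Flow of a centred observable (rule R3 of the quasi-locality calculus).** Let `O` be
centred at `x` with radius `r'` and tails `E` (`‖O − 𝔼_{b_x(r'+m)ᶜ}(O)‖ ≤ E m`). Under the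
hypotheses of `norm_flow_sub_twirl_pieces_le`, for an intermediate scale `m ≤ ℓ` with
`2(r+ℓ₀) ≤ ℓ − m`:
`‖α_s(O) − 𝔼_{b_x(r'+ℓ)ᶜ}(α_s(O))‖ ≤ 2 E m + 2‖O‖ |b_x(r'+m)| (exp(−μ⌊(ℓ−m+1)/(2(r+ℓ₀)+1)⌋ + 2e^μ J s) + (K/J) exp(2Js))`
(split `O` at scale `m`, evolve the local part with `norm_flow_sub_twirl_pieces_le`).
MZ13 §5.2 (the decompositions `𝒮(r'; ·)` applied to the already quasi-local `𝓕(Q_u)`).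
[folklore] -/
theorem norm_flow_sub_twirl_centred_le (r M : ℕ) {T : ℝ}
    (P : ℝ → TorusSite d L × Fin (M + 1) → Op (TorusSite d L × κ) q)
    (hPsupp : ∀ s (i : TorusSite d L × Fin (M + 1)),
      IsSupportedOn (P s i) (cellBall i.1 (r + i.2) : Finset (TorusSite d L × κ)))
    (hPherm : ∀ s i, (P s i).IsHermitian)
    (hPc : ∀ i, ContinuousOn (fun s => P s i) (Icc 0 T))
    {G : ℕ → ℝ} (hG0 : ∀ k, 0 ≤ G k) (hPG : ∀ s ∈ Icc 0 T, ∀ (u : TorusSite d L) (k : Fin (M + 1)),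
      ‖P s (u, k)‖ ≤ G k)
    {U : ℝ → Op (TorusSite d L × κ) q} (hU0 : U 0 = 1)
    (hU : ∀ s ∈ Icc 0 T, HasDerivWithinAt U (((I : ℂ) • localHamiltonian
      (fun Z : Finset (TorusSite d L × κ) => ∑ i ∈ univ.filter
        (fun i : TorusSite d L × Fin (M + 1) =>
          (cellBall i.1 (r + i.2) : Finset (TorusSite d L × κ)) = Z), P s i) univ) * U s) (Icc 0 T) s)
    (hU1 : ∀ s ∈ Icc 0 T, (U s)ᴴ * U s = 1) (hU2 : ∀ s ∈ Icc 0 T, U s * (U s)ᴴ = 1)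
    (x : TorusSite d L) {r' ℓ m ℓ₀ : ℕ} (hm : m ≤ ℓ) (hℓ : 2 * (r + ℓ₀) ≤ ℓ - m)
    {O : Op (TorusSite d L × κ) q} {E : ℕ → ℝ}
    (hcent : ∀ m' : ℕ, ‖O - twirl (cellBall x (r' + m'))ᶜ O‖ ≤ E m')
    {J : ℝ} (hJ1 : 1 ≤ J)
    (hJ : ∑ k : Fin (M + 1), ((2 * (r + k) + 1) ^ d : ℕ) *
      ((((2 * (r + k) + 1) ^ d * Fintype.card κ : ℕ) : ℝ) * G k) ≤ J)
    {K : ℝ} (hK0 : 0 ≤ K)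
    (hK : ∑ k : Fin (M + 1), (if ℓ₀ < (k : ℕ) then ((2 * (r + k) + 1) ^ d : ℕ) * G k else 0) ≤ K)
    {μ : ℝ} (hμ : 0 ≤ μ) {s : ℝ} (hs : s ∈ Icc 0 T) :
    ‖(U s)ᴴ * O * U s - twirl (cellBall x (r' + ℓ))ᶜ ((U s)ᴴ * O * U s)‖ ≤
      2 * E m + 2 * ‖O‖ * #(cellBall x (r' + m) : Finset (TorusSite d L × κ)) *
        (Real.exp (-(μ * ((((ℓ - m + 1) / (2 * (r + ℓ₀) + 1)) : ℕ) : ℝ)) + 2 * Real.exp μ * J * s) +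
          K / J * Real.exp (2 * J * s)) := by
  -- the local part at scale `m`
  set Om : Op (TorusSite d L × κ) q := twirl (cellBall x (r' + m))ᶜ O with hOm
  have hOm_supp : IsSupportedOn Om (cellBall x (r' + m)) := isSupportedOn_twirl_compl _ O
  have hOm_norm : ‖Om‖ ≤ ‖O‖ := norm_twirl_le _ O
  have hdiff : ‖O - Om‖ ≤ E m := hcent m
  have hUu : U s ∈ unitary (Op (TorusSite d L × κ) q) :=
    Matrix.mem_unitaryGroup_iff'.mpr (hU1 s hs)
  have hUu' : (U s)ᴴ ∈ unitary (Op (TorusSite d L × κ) q) := by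
    rw [← star_eq_conjTranspose]; exact Unitary.star_mem hUu
  -- split
  have hsplit : (U s)ᴴ * O * U s - twirl (cellBall x (r' + ℓ))ᶜ ((U s)ᴴ * O * U s) =
      ((U s)ᴴ * (O - Om) * U s - twirl (cellBall x (r' + ℓ))ᶜ ((U s)ᴴ * (O - Om) * U s)) +
      ((U s)ᴴ * Om * U s - twirl (cellBall x (r' + ℓ))ᶜ ((U s)ᴴ * Om * U s)) := by
    rw [conj_sub, twirl_sub]; abel
  rw [hsplit]
  refine (norm_add_le _ _).trans (add_le_add ?_ ?_)
  · -- the tail: `α` is isometric, the twirl is contractive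
    calc ‖(U s)ᴴ * (O - Om) * U s - twirl (cellBall x (r' + ℓ))ᶜ ((U s)ᴴ * (O - Om) * U s)‖
        ≤ ‖(U s)ᴴ * (O - Om) * U s‖ + ‖twirl (cellBall x (r' + ℓ))ᶜ ((U s)ᴴ * (O - Om) * U s)‖ :=
          norm_sub_le _ _
      _ ≤ ‖(U s)ᴴ * (O - Om) * U s‖ + ‖(U s)ᴴ * (O - Om) * U s‖ :=
          add_le_add le_rfl (norm_twirl_le _ _)
      _ = 2 * ‖O - Om‖ := by rw [norm_unitary_mul_mul_unitary hUu' hUu]; ring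
      _ ≤ 2 * E m := by linarith
  · -- the local part: `norm_flow_sub_twirl_pieces_le` between the radii `r'+m` and `r'+ℓ`
    have hrad : r' + ℓ = (r' + m) + (ℓ - m) := by omega
    rw [hrad]
    have h := norm_flow_sub_twirl_pieces_le r M P hPsupp hPherm hPc hG0 hPG hU0 hU hU1 hU2 x hℓ
      hOm_supp hJ1 hJ hK0 hK hμ hs
    refine h.trans ?_
    have hE : 0 ≤ Real.exp (-(μ * ((((ℓ - m + 1) / (2 * (r + ℓ₀) + 1)) : ℕ) : ℝ)) +
        2 * Real.exp μ * J * s) + K / J * Real.exp (2 * J * s) := by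
      have hJ0 : 0 ≤ J := zero_le_one.trans hJ1
      positivity
    gcongr

end CentredTorus

/-! ### Decay toolkit for the power-bound format `C/(ℓ+1)^p` -/

section DecayToolkit

/-- `exp(−a√ℓ) ≤ (2p)! / (a^{2p}) · 2^p/(ℓ+1)^p` for `ℓ ≥ 1`… stated for all `ℓ` with the
harmless form `exp(−a √ℓ) ≤ ((2p)! 2^p / a^(2p)) / (ℓ+1)^p + [ℓ = 0]`; we use the version with
`√(ℓ+1)`: `exp(−a √(ℓ+1)) ≤ ((2p)!/a^(2p)) / (ℓ+1)^p`. [folklore] -/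
theorem exp_neg_mul_sqrt_le {a : ℝ} (ha : 0 < a) (p ℓ : ℕ) :
    Real.exp (-(a * Real.sqrt ((ℓ : ℝ) + 1))) ≤
      ((Nat.factorial (2 * p) : ℝ) / a ^ (2 * p)) / ((ℓ : ℝ) + 1) ^ p := by
  have hℓ : (0 : ℝ) < (ℓ : ℝ) + 1 := by positivity
  have hs : 0 < Real.sqrt ((ℓ : ℝ) + 1) := Real.sqrt_pos.mpr hℓ
  have hx : 0 < a * Real.sqrt ((ℓ : ℝ) + 1) := mul_pos ha hs
  refine (exp_neg_le_factorial_div_pow hx (2 * p)).trans (le_of_eq ?_)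
  rw [mul_pow, pow_mul, pow_mul (Real.sqrt _), Real.sq_sqrt hℓ.le, div_div]

/-- `1/(√(ℓ+1)' + 1)^(2p) ≤ 1/(ℓ+1)^p`-type comparison in the form used for the splitting scale
`ℓ₀ = Nat.sqrt ℓ`: `(ℓ + 1) ≤ (Nat.sqrt ℓ + 1)^2`. [folklore] -/
theorem succ_le_sqrt_succ_sq (ℓ : ℕ) : ((ℓ : ℝ) + 1) ≤ ((Nat.sqrt ℓ : ℝ) + 1) ^ 2 := by
  have h := Nat.lt_succ_sqrt ℓ   -- ℓ < (sqrt ℓ + 1)^2 in ℕ (as succ (sqrt ℓ) * succ (sqrt ℓ))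
  have h' : ℓ + 1 ≤ (Nat.sqrt ℓ + 1) * (Nat.sqrt ℓ + 1) := h
  calc ((ℓ : ℝ) + 1) = ((ℓ + 1 : ℕ) : ℝ) := by push_cast; ring
    _ ≤ (((Nat.sqrt ℓ + 1) * (Nat.sqrt ℓ + 1) : ℕ) : ℝ) := by exact_mod_cast h'
    _ = ((Nat.sqrt ℓ : ℝ) + 1) ^ 2 := by push_cast; ring

/-- Power bounds at the scale `Nat.sqrt ℓ` give power bounds at the scale `ℓ` with half the
exponent: `C/(Nat.sqrt ℓ + 1)^(2p) ≤ C/(ℓ+1)^p` for `C ≥ 0`. [folklore] -/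
theorem div_sqrt_pow_le {C : ℝ} (hC : 0 ≤ C) (p ℓ : ℕ) :
    C / ((Nat.sqrt ℓ : ℝ) + 1) ^ (2 * p) ≤ C / ((ℓ : ℝ) + 1) ^ p := by
  have hℓ : (0 : ℝ) < (ℓ : ℝ) + 1 := by positivity
  rw [pow_mul]
  exact div_le_div_of_nonneg_left hC (pow_pos hℓ p)
    (pow_le_pow_left₀ hℓ.le (succ_le_sqrt_succ_sq ℓ) p)

/-- Power bounds at the scale `ℓ/2`: `C/(ℓ/2 + 1)^p ≤ 2^p C/(ℓ+1)^p` (`ℕ`-division). [folklore] -/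
theorem div_half_pow_le {C : ℝ} (hC : 0 ≤ C) (p ℓ : ℕ) :
    C / (((ℓ / 2 : ℕ) : ℝ) + 1) ^ p ≤ 2 ^ p * C / ((ℓ : ℝ) + 1) ^ p := by
  have hℓ : (0 : ℝ) < (ℓ : ℝ) + 1 := by positivity
  have hh : (0 : ℝ) < ((ℓ / 2 : ℕ) : ℝ) + 1 := by positivity
  have hkey : (ℓ : ℝ) + 1 ≤ 2 * (((ℓ / 2 : ℕ) : ℝ) + 1) := by
    have h1 : ℓ < 2 * (ℓ / 2 + 1) := by omega
    have h2 : (ℓ : ℝ) + 1 ≤ ((2 * (ℓ / 2 + 1) : ℕ) : ℝ) := by exact_mod_cast h1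
    calc (ℓ : ℝ) + 1 ≤ ((2 * (ℓ / 2 + 1) : ℕ) : ℝ) := h2
      _ = 2 * (((ℓ / 2 : ℕ) : ℝ) + 1) := by push_cast; ring
  rw [div_le_div_iff₀ (pow_pos hh p) (pow_pos hℓ p)]
  calc C * ((ℓ : ℝ) + 1) ^ p ≤ C * (2 * (((ℓ / 2 : ℕ) : ℝ) + 1)) ^ p :=
        mul_le_mul_of_nonneg_left (pow_le_pow_left₀ hℓ.le hkey p) hC
    _ = 2 ^ p * C * ((((ℓ / 2 : ℕ) : ℝ)) + 1) ^ p := by rw [mul_pow]; ring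

/-- The floor appearing in the two-scale flow bound is at least of order `√ℓ`:
for `ℓ₀ = Nat.sqrt ℓ`, `m = ℓ/2`, the integer `(ℓ − m + 1)/(2(r+ℓ₀)+1)` satisfies
`√(ℓ+1)/(4r+6) − 1 ≤ ⌊(ℓ − ℓ/2 + 1)/(2(r + Nat.sqrt ℓ) + 1)⌋`. [folklore] -/
theorem sqrt_div_sub_one_le_floor (r ℓ : ℕ) :
    Real.sqrt ((ℓ : ℝ) + 1) / (4 * r + 6) - 1 ≤
      ((((ℓ - ℓ / 2 + 1) / (2 * (r + Nat.sqrt ℓ) + 1) : ℕ) : ℝ)) := by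
  set D : ℕ := 2 * (r + Nat.sqrt ℓ) + 1 with hD
  set N : ℕ := ℓ - ℓ / 2 + 1 with hN
  have hD0 : (0 : ℝ) < (D : ℝ) := by positivity
  -- floor ≥ N/D - 1
  have hfloor : (N : ℝ) / D - 1 ≤ ((N / D : ℕ) : ℝ) := by
    have h1 : N < D * (N / D + 1) := by
      have := Nat.lt_succ_iff.mpr (le_refl (N / D))
      exact Nat.lt_mul_div_succ N (by positivity)
    have h2 : (N : ℝ) < (D : ℝ) * (((N / D : ℕ) : ℝ) + 1) := by exact_mod_cast h1
    rw [div_sub_one hD0.ne', div_le_iff₀ hD0]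
    nlinarith
  refine le_trans ?_ hfloor
  -- compare `√(ℓ+1)/(4r+6)` with `N/D`
  have hs1 : 1 ≤ Real.sqrt ((ℓ : ℝ) + 1) :=
    Real.one_le_sqrt.mpr (by have := (Nat.cast_nonneg ℓ : (0 : ℝ) ≤ ℓ); linarith)
  have hsq : Real.sqrt ((ℓ : ℝ) + 1) ^ 2 = (ℓ : ℝ) + 1 := Real.sq_sqrt (by positivity)
  have hsqrtℓ : (Nat.sqrt ℓ : ℝ) ≤ Real.sqrt ((ℓ : ℝ) + 1) := by
    rw [Real.le_sqrt (by positivity) (by positivity)]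
    have : ((Nat.sqrt ℓ) ^ 2 : ℕ) ≤ ℓ := Nat.sqrt_le' ℓ
    have : ((Nat.sqrt ℓ : ℝ)) ^ 2 ≤ (ℓ : ℝ) := by exact_mod_cast this
    linarith
  -- `D ≤ (4r+6)/2 · √(ℓ+1)`… precisely `D = 2r + 1 + 2 sqrt ℓ ≤ (2r+1)√(ℓ+1) + 2√(ℓ+1) = (2r+3)√(ℓ+1)`
  have hDle : (D : ℝ) ≤ (2 * r + 3) * Real.sqrt ((ℓ : ℝ) + 1) := by
    have : (D : ℝ) = 2 * r + 1 + 2 * (Nat.sqrt ℓ : ℝ) := by rw [hD]; push_cast; ring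
    rw [this]
    nlinarith
  -- `N ≥ (ℓ+1)/2`
  have hNge : ((ℓ : ℝ) + 1) / 2 ≤ (N : ℝ) := by
    have h1 : ℓ + 1 ≤ 2 * N := by omega
    have h2 : ((ℓ : ℝ) + 1) ≤ 2 * (N : ℝ) := by exact_mod_cast h1
    linarith
  rw [sub_le_sub_iff_right, div_le_div_iff₀ (by positivity) hD0]
  calc Real.sqrt ((ℓ : ℝ) + 1) * D ≤ Real.sqrt ((ℓ : ℝ) + 1) * ((2 * r + 3) * Real.sqrt ((ℓ : ℝ) + 1)) :=
        mul_le_mul_of_nonneg_left hDle (by positivity)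
    _ = (2 * r + 3) * ((ℓ : ℝ) + 1) := by rw [mul_left_comm, ← pow_two, hsq]
    _ = ((ℓ : ℝ) + 1) / 2 * (4 * r + 6) := by ring
    _ ≤ N * (4 * r + 6) := mul_le_mul_of_nonneg_right hNge (by positivity)

/-- **The exponential term of the two-scale flow bound is superpolynomially small**:
`exp(−μ ⌊(ℓ − ℓ/2 + 1)/(2(r + Nat.sqrt ℓ)+1)⌋) ≤ e^μ ((2p)!/(μ/(4r+6))^(2p)) / (ℓ+1)^p`. [folklore] -/
theorem exp_neg_mul_floor_le_div_pow {μ : ℝ} (hμ : 0 < μ) (r p ℓ : ℕ) :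
    Real.exp (-(μ * ((((ℓ - ℓ / 2 + 1) / (2 * (r + Nat.sqrt ℓ) + 1) : ℕ) : ℝ)))) ≤
      Real.exp μ * (((Nat.factorial (2 * p) : ℝ) / (μ / (4 * r + 6)) ^ (2 * p)) / ((ℓ : ℝ) + 1) ^ p) := by
  have hfl := sqrt_div_sub_one_le_floor r ℓ
  have ha : 0 < μ / (4 * r + 6) := div_pos hμ (by positivity)
  have h1 : Real.exp (-(μ * ((((ℓ - ℓ / 2 + 1) / (2 * (r + Nat.sqrt ℓ) + 1) : ℕ) : ℝ)))) ≤
      Real.exp (-(μ * (Real.sqrt ((ℓ : ℝ) + 1) / (4 * r + 6) - 1))) := by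
    rw [Real.exp_le_exp, neg_le_neg_iff]
    exact mul_le_mul_of_nonneg_left hfl hμ.le
  refine h1.trans ?_
  have h2 : -(μ * (Real.sqrt ((ℓ : ℝ) + 1) / (4 * r + 6) - 1)) =
      μ + -((μ / (4 * r + 6)) * Real.sqrt ((ℓ : ℝ) + 1)) := by ring
  rw [h2, Real.exp_add]
  exact mul_le_mul_of_nonneg_left (exp_neg_mul_sqrt_le ha p ℓ) (Real.exp_pos μ).le


end DecayToolkit

/-! ### The flow of a centred observable, in the power-bound format -/

section CentredTorusPow

open Finset Literature.Probability.LatticeModels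

variable {d L : ℕ} [NeZero L] {κ : Type*} [Fintype κ] [DecidableEq κ] {q : ℕ}

/-- The long-range local norm at the splitting scale: `Σ_k [ℓ₀ < k] (2(r+k)+1)^d G k ≤
2(2r+2)^d C/(ℓ₀+1)^p'` when `G k ≤ C/(k+1)^(p'+d+2)`. [folklore] -/
theorem sum_fin_indicator_le {G : ℕ → ℝ} {C : ℝ} (hC : 0 ≤ C) (r p' ℓ₀ M : ℕ)
    (hG : ∀ k : ℕ, G k ≤ C / ((k : ℝ) + 1) ^ (p' + d + 2)) (hG0 : ∀ k, 0 ≤ G k) :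
    ∑ k : Fin (M + 1), (if ℓ₀ < (k : ℕ) then (((2 * (r + k) + 1) ^ d : ℕ) : ℝ) * G k else 0) ≤
      2 * (2 * (r : ℝ) + 2) ^ d * C / ((ℓ₀ : ℝ) + 1) ^ p' := by
  have h1 : ∑ k : Fin (M + 1), (if ℓ₀ < (k : ℕ) then (((2 * (r + k) + 1) ^ d : ℕ) : ℝ) * G k else 0) =
      ∑ k ∈ Finset.range (M + 1),
        (if ℓ₀ < k then (((2 * (r + k) + 1) ^ d : ℕ) : ℝ) * G k else 0) :=
    (Fin.sum_univ_eq_sum_range (fun k => (if ℓ₀ < k then (((2 * (r + k) + 1) ^ d : ℕ) : ℝ) * G k else 0)) (M + 1))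
  rw [h1]
  have h2 : ∀ k ∈ Finset.range (M + 1),
      (if ℓ₀ < k then (((2 * (r + k) + 1) ^ d : ℕ) : ℝ) * G k else 0) ≤
        (if ℓ₀ < k then ((2 * (r : ℝ) + 2) * ((k : ℝ) + 1)) ^ d * G k else 0) := by
    intro k _
    split_ifs
    · refine mul_le_mul_of_nonneg_right ?_ (hG0 k)
      have : ((2 * (r + k) + 1 : ℕ) : ℝ) ≤ (2 * (r : ℝ) + 2) * ((k : ℝ) + 1) := by
        push_cast; nlinarith [(Nat.cast_nonneg k : (0 : ℝ) ≤ k), (Nat.cast_nonneg r : (0 : ℝ) ≤ r)]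
      calc (((2 * (r + k) + 1) ^ d : ℕ) : ℝ) = ((2 * (r + k) + 1 : ℕ) : ℝ) ^ d := by push_cast; ring
        _ ≤ _ := pow_le_pow_left₀ (by positivity) this d
    · exact le_rfl
  refine (Finset.sum_le_sum h2).trans ?_
  exact sum_indicator_pow_mul_le hC (by positivity) p' d hG ℓ₀ M

/-- Arithmetic of the two scales: for `ℓ ≥ (4r+8)²` the splitting scale `Nat.sqrt ℓ` fits,
`2(r + Nat.sqrt ℓ) ≤ ℓ − ℓ/2`. [folklore] -/
theorem two_mul_add_sqrt_le {r ℓ : ℕ} (h : (4 * r + 8) ^ 2 ≤ ℓ) : 2 * (r + Nat.sqrt ℓ) ≤ ℓ - ℓ / 2 := by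
  have h1 : 4 * r + 8 ≤ Nat.sqrt ℓ := Nat.le_sqrt'.mpr h
  have h2 : Nat.sqrt ℓ * Nat.sqrt ℓ ≤ ℓ := Nat.sqrt_le ℓ
  have h5 : (4 * r + 8) * Nat.sqrt ℓ ≤ ℓ := (Nat.mul_le_mul_right _ h1).trans h2
  have hs1 : 1 ≤ Nat.sqrt ℓ := le_trans (by omega) h1
  have h3 : 4 * r ≤ 4 * r * Nat.sqrt ℓ := Nat.le_mul_of_pos_right _ hs1
  have h6 : 4 * (r + Nat.sqrt ℓ) ≤ (4 * r + 8) * Nat.sqrt ℓ := by nlinarith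
  have h7 : 4 * (r + Nat.sqrt ℓ) ≤ ℓ := h6.trans h5
  omega

/-- Cast form of `ℓ < (4r+8)²`. [folklore] -/
theorem cast_succ_le_of_lt_sq {r ℓ : ℕ} (h : ℓ < (4 * r + 8) ^ 2) :
    (ℓ : ℝ) + 1 ≤ (4 * (r : ℝ) + 8) ^ 2 + 1 := by
  have : ((ℓ : ℝ)) ≤ (4 * (r : ℝ) + 8) ^ 2 := by exact_mod_cast h.le
  linarith

/-- **Flow of a centred observable, power-bound format (MZ13 §5.2 / Lemma 2 packaged).** In
the setting of `norm_flow_sub_twirl_centred_le`, if the generator pieces decay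
superpolynomially (`G k ≤ C_G n/(k+1)^n` for all `n`) and the observable `O` (norm `≤ N₀`) is
centred at `x` with superpolynomial tails (`E m ≤ C_E n/(m+1)^n`), then for `0 ≤ s ≤ T ≤ 1`
the evolved observable `α_s(O) = U(s)ᴴ O U(s)` is centred at `x` with superpolynomial tails,
with constants depending only on `(d, |κ|, r, r', J, N₀, C_G, C_E)`:
`‖α_s(O) − 𝔼_{b_x(r'+ℓ)ᶜ}(α_s(O))‖ ≤ Bd p/(ℓ+1)^p`. [cite: MichalakisZwolakCMP2013, §5.2 Lemma 2 (arXiv:1109.1588 p. 12)] -/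
theorem norm_flow_sub_twirl_centred_le_div_pow (r M : ℕ) {T : ℝ} (hT1 : T ≤ 1)
    (P : ℝ → TorusSite d L × Fin (M + 1) → Op (TorusSite d L × κ) q)
    (hPsupp : ∀ s (i : TorusSite d L × Fin (M + 1)),
      IsSupportedOn (P s i) (cellBall i.1 (r + i.2) : Finset (TorusSite d L × κ)))
    (hPherm : ∀ s i, (P s i).IsHermitian)
    (hPc : ∀ i, ContinuousOn (fun s => P s i) (Icc 0 T))
    {G : ℕ → ℝ} (hG0 : ∀ k, 0 ≤ G k) (hPG : ∀ s ∈ Icc 0 T, ∀ (u : TorusSite d L) (k : Fin (M + 1)),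
      ‖P s (u, k)‖ ≤ G k)
    {C_G : ℕ → ℝ} (hCG0 : ∀ n, 0 ≤ C_G n) (hG : ∀ n k, G k ≤ C_G n / ((k : ℝ) + 1) ^ n)
    {U : ℝ → Op (TorusSite d L × κ) q} (hU0 : U 0 = 1)
    (hU : ∀ s ∈ Icc 0 T, HasDerivWithinAt U (((I : ℂ) • localHamiltonian
      (fun Z : Finset (TorusSite d L × κ) => ∑ i ∈ univ.filter
        (fun i : TorusSite d L × Fin (M + 1) =>
          (cellBall i.1 (r + i.2) : Finset (TorusSite d L × κ)) = Z), P s i) univ) * U s) (Icc 0 T) s)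
    (hU1 : ∀ s ∈ Icc 0 T, (U s)ᴴ * U s = 1) (hU2 : ∀ s ∈ Icc 0 T, U s * (U s)ᴴ = 1)
    (x : TorusSite d L) {r' : ℕ} {O : Op (TorusSite d L × κ) q} {N₀ : ℝ} (hO : ‖O‖ ≤ N₀)
    {E : ℕ → ℝ} (hcent : ∀ m' : ℕ, ‖O - twirl (cellBall x (r' + m'))ᶜ O‖ ≤ E m')
    {C_E : ℕ → ℝ} (hCE0 : ∀ n, 0 ≤ C_E n) (hE : ∀ n m, E m ≤ C_E n / ((m : ℝ) + 1) ^ n)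
    {J : ℝ} (hJ1 : 1 ≤ J)
    (hJ : ∑ k : Fin (M + 1), ((2 * (r + k) + 1) ^ d : ℕ) *
      ((((2 * (r + k) + 1) ^ d * Fintype.card κ : ℕ) : ℝ) * G k) ≤ J)
    {s : ℝ} (hs : s ∈ Icc 0 T) (p ℓ : ℕ) :
    ‖(U s)ᴴ * O * U s - twirl (cellBall x (r' + ℓ))ᶜ ((U s)ᴴ * O * U s)‖ ≤
      (2 * 2 ^ p * C_E p +
        2 * N₀ * ((2 * (r' : ℝ) + 1) ^ d * Fintype.card κ) *
          (Real.exp (2 * Real.exp 1 * J + 1) *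
            ((Nat.factorial (2 * (p + d)) : ℝ) / (1 / (4 * r + 6)) ^ (2 * (p + d))) +
           Real.exp (2 * J) * (2 * (2 * (r : ℝ) + 2) ^ d * C_G (2 * (p + d) + d + 2))) +
        2 * N₀ * ((4 * (r : ℝ) + 8) ^ 2 + 1) ^ p) / ((ℓ : ℝ) + 1) ^ p := by
  have hN0 : 0 ≤ N₀ := (norm_nonneg O).trans hO
  have hℓ1 : (0 : ℝ) < (ℓ : ℝ) + 1 := by positivity
  have hs0 : 0 ≤ s := hs.1
  have hs1 : s ≤ 1 := hs.2.trans hT1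
  have hJ0 : 0 ≤ J := zero_le_one.trans hJ1
  have hUu : U s ∈ unitary (Op (TorusSite d L × κ) q) :=
    Matrix.mem_unitaryGroup_iff'.mpr (hU1 s hs)
  have hUu' : (U s)ᴴ ∈ unitary (Op (TorusSite d L × κ) q) := by
    rw [← star_eq_conjTranspose]; exact Unitary.star_mem hUu
  -- abbreviations for the three constants
  set K₁ : ℝ := 2 * 2 ^ p * C_E p with hK₁
  set K₂ : ℝ := 2 * N₀ * ((2 * (r' : ℝ) + 1) ^ d * Fintype.card κ) *
    (Real.exp (2 * Real.exp 1 * J + 1) *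
      ((Nat.factorial (2 * (p + d)) : ℝ) / (1 / (4 * r + 6)) ^ (2 * (p + d))) +
     Real.exp (2 * J) * (2 * (2 * (r : ℝ) + 2) ^ d * C_G (2 * (p + d) + d + 2))) with hK₂
  set K₃ : ℝ := 2 * N₀ * ((4 * (r : ℝ) + 8) ^ 2 + 1) ^ p with hK₃
  have hK₁0 : 0 ≤ K₁ := by rw [hK₁]; have := hCE0 p; positivity
  have hK₂0 : 0 ≤ K₂ := by rw [hK₂]; have := hCG0 (2 * (p + d) + d + 2); positivity
  have hK₃0 : 0 ≤ K₃ := by rw [hK₃]; positivity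
  -- trivial bound, used for small `ℓ`
  have htriv : ‖(U s)ᴴ * O * U s - twirl (cellBall x (r' + ℓ))ᶜ ((U s)ᴴ * O * U s)‖ ≤ 2 * N₀ := by
    calc _ ≤ ‖(U s)ᴴ * O * U s‖ + ‖twirl (cellBall x (r' + ℓ))ᶜ ((U s)ᴴ * O * U s)‖ := norm_sub_le _ _
      _ ≤ ‖(U s)ᴴ * O * U s‖ + ‖(U s)ᴴ * O * U s‖ := add_le_add le_rfl (norm_twirl_le _ _)
      _ = 2 * ‖O‖ := by rw [norm_unitary_mul_mul_unitary hUu' hUu]; ring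
      _ ≤ 2 * N₀ := by linarith
  by_cases hbig : 2 * (r + Nat.sqrt ℓ) ≤ ℓ - ℓ / 2
  · -- the two-scale bound with `m = ℓ/2`, `ℓ₀ = Nat.sqrt ℓ`, `μ = 1`
    have hm : ℓ / 2 ≤ ℓ := Nat.div_le_self ℓ 2
    -- the long-range local norm `K`
    have hKdef := sum_fin_indicator_le (d := d) (hCG0 (2 * (p + d) + d + 2)) r (2 * (p + d)) (Nat.sqrt ℓ) M
      (hG (2 * (p + d) + d + 2)) hG0
    set K : ℝ := 2 * (2 * (r : ℝ) + 2) ^ d * C_G (2 * (p + d) + d + 2) /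
      ((Nat.sqrt ℓ : ℝ) + 1) ^ (2 * (p + d)) with hK
    have hKnn : 0 ≤ K := by rw [hK]; have := hCG0 (2 * (p + d) + d + 2); positivity
    have h := norm_flow_sub_twirl_centred_le r M P hPsupp hPherm hPc hG0 hPG hU0 hU hU1 hU2 x hm hbig
      hcent hJ1 hJ hKnn hKdef zero_le_one hs
    refine h.trans ?_
    -- bound the three terms
    have hcard : (#(cellBall x (r' + ℓ / 2) : Finset (TorusSite d L × κ)) : ℝ) ≤
        ((2 * (r' : ℝ) + 1) ^ d * Fintype.card κ) * ((ℓ : ℝ) + 1) ^ d := by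
      have h1 := card_cellBall_le (κ := κ) x (r' + ℓ / 2)
      have h2 : (#(cellBall x (r' + ℓ / 2) : Finset (TorusSite d L × κ)) : ℝ) ≤
          (((2 * (r' + ℓ / 2) + 1) ^ d * Fintype.card κ : ℕ) : ℝ) := by exact_mod_cast h1
      refine h2.trans ?_
      have h3 : ((2 * (r' + ℓ / 2) + 1 : ℕ) : ℝ) ≤ (2 * (r' : ℝ) + 1) * ((ℓ : ℝ) + 1) := by
        have h4 : 2 * (r' + ℓ / 2) + 1 ≤ (2 * r' + 1) * (ℓ + 1) := by nlinarith [Nat.div_mul_le_self ℓ 2]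
        have h5 : ((2 * (r' + ℓ / 2) + 1 : ℕ) : ℝ) ≤ (((2 * r' + 1) * (ℓ + 1) : ℕ) : ℝ) := by exact_mod_cast h4
        refine h5.trans (le_of_eq ?_); push_cast; ring
      calc (((2 * (r' + ℓ / 2) + 1) ^ d * Fintype.card κ : ℕ) : ℝ)
          = ((2 * (r' + ℓ / 2) + 1 : ℕ) : ℝ) ^ d * Fintype.card κ := by push_cast; ring
        _ ≤ ((2 * (r' : ℝ) + 1) * ((ℓ : ℝ) + 1)) ^ d * Fintype.card κ :=
            mul_le_mul_of_nonneg_right (pow_le_pow_left₀ (by positivity) h3 d) (Nat.cast_nonneg _)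
        _ = _ := by rw [mul_pow]; ring
    -- (a) the tail of `O`
    have ha : 2 * E (ℓ / 2) ≤ K₁ / ((ℓ : ℝ) + 1) ^ p := by
      have h1 := hE p (ℓ / 2)
      have h2 := div_half_pow_le (hCE0 p) p ℓ
      rw [hK₁]
      have : 2 * 2 ^ p * C_E p / ((ℓ : ℝ) + 1) ^ p = 2 * (2 ^ p * C_E p / ((ℓ : ℝ) + 1) ^ p) := by ring
      rw [this]
      linarith
    -- (b) the exponential term
    have hexp := exp_neg_mul_floor_le_div_pow one_pos r (p + d) ℓ
    have hb : Real.exp (-(1 * ((((ℓ - ℓ / 2 + 1) / (2 * (r + Nat.sqrt ℓ) + 1)) : ℕ) : ℝ)) +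
        2 * Real.exp 1 * J * s) ≤
        Real.exp (2 * Real.exp 1 * J + 1) *
          (((Nat.factorial (2 * (p + d)) : ℝ) / (1 / (4 * r + 6)) ^ (2 * (p + d))) /
            ((ℓ : ℝ) + 1) ^ (p + d)) := by
      have h1 : Real.exp (2 * Real.exp 1 * J * s) ≤ Real.exp (2 * Real.exp 1 * J) := by
        rw [Real.exp_le_exp]
        have : 0 ≤ 2 * Real.exp 1 * J := by positivity
        nlinarith
      have hF0 : 0 ≤ Real.exp 1 * (((Nat.factorial (2 * (p + d)) : ℝ) / (1 / (4 * r + 6)) ^ (2 * (p + d))) /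
          ((ℓ : ℝ) + 1) ^ (p + d)) := by positivity
      calc Real.exp (-(1 * ((((ℓ - ℓ / 2 + 1) / (2 * (r + Nat.sqrt ℓ) + 1)) : ℕ) : ℝ)) +
            2 * Real.exp 1 * J * s)
          = Real.exp (-(1 * ((((ℓ - ℓ / 2 + 1) / (2 * (r + Nat.sqrt ℓ) + 1)) : ℕ) : ℝ))) *
              Real.exp (2 * Real.exp 1 * J * s) := Real.exp_add _ _
        _ ≤ (Real.exp 1 * (((Nat.factorial (2 * (p + d)) : ℝ) / (1 / (4 * r + 6)) ^ (2 * (p + d))) /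
              ((ℓ : ℝ) + 1) ^ (p + d))) * Real.exp (2 * Real.exp 1 * J) :=
            mul_le_mul hexp h1 (Real.exp_pos _).le hF0
        _ = _ := by rw [Real.exp_add]; ring
    -- (c) the long-range term
    have hc : K / J * Real.exp (2 * J * s) ≤
        Real.exp (2 * J) * (2 * (2 * (r : ℝ) + 2) ^ d * C_G (2 * (p + d) + d + 2)) / ((ℓ : ℝ) + 1) ^ (p + d) := by
      have h1 : K / J ≤ K := div_le_self hKnn hJ1
      have h2 : Real.exp (2 * J * s) ≤ Real.exp (2 * J) := by
        rw [Real.exp_le_exp]; nlinarith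
      have h3 : K ≤ 2 * (2 * (r : ℝ) + 2) ^ d * C_G (2 * (p + d) + d + 2) / ((ℓ : ℝ) + 1) ^ (p + d) := by
        rw [hK]
        exact div_sqrt_pow_le (C := 2 * (2 * (r : ℝ) + 2) ^ d * C_G (2 * (p + d) + d + 2))
          (by have := hCG0 (2 * (p + d) + d + 2); positivity) (p + d) ℓ
      calc K / J * Real.exp (2 * J * s) ≤ K * Real.exp (2 * J) :=
            mul_le_mul h1 h2 (Real.exp_pos _).le hKnn
        _ ≤ (2 * (2 * (r : ℝ) + 2) ^ d * C_G (2 * (p + d) + d + 2) / ((ℓ : ℝ) + 1) ^ (p + d)) * Real.exp (2 * J) :=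
            mul_le_mul_of_nonneg_right h3 (Real.exp_pos _).le
        _ = _ := by ring
    -- combine (b) and (c) with the prefactor
    have hbc : 2 * ‖O‖ * (#(cellBall x (r' + ℓ / 2) : Finset (TorusSite d L × κ)) : ℝ) *
        (Real.exp (-(1 * ((((ℓ - ℓ / 2 + 1) / (2 * (r + Nat.sqrt ℓ) + 1)) : ℕ) : ℝ)) +
          2 * Real.exp 1 * J * s) + K / J * Real.exp (2 * J * s)) ≤ K₂ / ((ℓ : ℝ) + 1) ^ p := by
      have hpre : 2 * ‖O‖ * (#(cellBall x (r' + ℓ / 2) : Finset (TorusSite d L × κ)) : ℝ) ≤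
          2 * N₀ * (((2 * (r' : ℝ) + 1) ^ d * Fintype.card κ) * ((ℓ : ℝ) + 1) ^ d) :=
        mul_le_mul (mul_le_mul_of_nonneg_left hO zero_le_two) hcard (Nat.cast_nonneg _) (by positivity)
      have hsum := add_le_add hb hc
      have hbr0 : 0 ≤ Real.exp (-(1 * ((((ℓ - ℓ / 2 + 1) / (2 * (r + Nat.sqrt ℓ) + 1)) : ℕ) : ℝ)) +
          2 * Real.exp 1 * J * s) + K / J * Real.exp (2 * J * s) := by positivity
      calc _ ≤ 2 * N₀ * (((2 * (r' : ℝ) + 1) ^ d * Fintype.card κ) * ((ℓ : ℝ) + 1) ^ d) *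
            (Real.exp (2 * Real.exp 1 * J + 1) *
              (((Nat.factorial (2 * (p + d)) : ℝ) / (1 / (4 * r + 6)) ^ (2 * (p + d))) /
                ((ℓ : ℝ) + 1) ^ (p + d)) +
             Real.exp (2 * J) * (2 * (2 * (r : ℝ) + 2) ^ d * C_G (2 * (p + d) + d + 2)) /
               ((ℓ : ℝ) + 1) ^ (p + d)) :=
            mul_le_mul hpre hsum hbr0 (by positivity)
        _ = K₂ / ((ℓ : ℝ) + 1) ^ p := by
            rw [hK₂, pow_add]
            field_simp
    calc 2 * E (ℓ / 2) + 2 * ‖O‖ * (#(cellBall x (r' + ℓ / 2) : Finset (TorusSite d L × κ)) : ℝ) *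
          (Real.exp (-(1 * ((((ℓ - ℓ / 2 + 1) / (2 * (r + Nat.sqrt ℓ) + 1)) : ℕ) : ℝ)) +
            2 * Real.exp 1 * J * s) + K / J * Real.exp (2 * J * s))
        ≤ K₁ / ((ℓ : ℝ) + 1) ^ p + K₂ / ((ℓ : ℝ) + 1) ^ p := add_le_add ha hbc
      _ ≤ (K₁ + K₂ + K₃) / ((ℓ : ℝ) + 1) ^ p := by
          rw [← add_div]
          exact div_le_div_of_nonneg_right (by linarith) (pow_pos hℓ1 p).le
  · -- small `ℓ`: `ℓ < (4r+8)^2`, trivial bound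
    have hsmall : ℓ < (4 * r + 8) ^ 2 := by
      by_contra hcon
      exact hbig (two_mul_add_sqrt_le (not_lt.mp hcon))
    have hpow : ((ℓ : ℝ) + 1) ^ p ≤ ((4 * (r : ℝ) + 8) ^ 2 + 1) ^ p :=
      pow_le_pow_left₀ hℓ1.le (cast_succ_le_of_lt_sq hsmall) p
    calc ‖(U s)ᴴ * O * U s - twirl (cellBall x (r' + ℓ))ᶜ ((U s)ᴴ * O * U s)‖ ≤ 2 * N₀ := htriv
      _ = K₃ / ((4 * (r : ℝ) + 8) ^ 2 + 1) ^ p := by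
          rw [hK₃, mul_div_assoc, div_self (pow_pos (by positivity) p).ne', mul_one]
      _ ≤ K₃ / ((ℓ : ℝ) + 1) ^ p := div_le_div_of_nonneg_left hK₃0 (pow_pos hℓ1 p) hpow
      _ ≤ (K₁ + K₂ + K₃) / ((ℓ : ℝ) + 1) ^ p :=
          div_le_div_of_nonneg_right (by linarith) (pow_pos hℓ1 p).le

end CentredTorusPow

end Literature.MathematicalPhysics.QuantumLattice
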